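import Literature.AlgebraicGeometry.Resolution.HironakaGroupSchemeExponent
import HarnessLib

/-!
# Hironaka's additive group schemes over a PERFECT field have exponent `0` (Oda 1983-II, Cor. 2.3, case `e = 0`)

Topic: `Literature/AlgebraicGeometry/Resolution`; sub-namespace `HironakaScheme` (vocabulary of
`HironakaGroupScheme.lean`: T. Oda, *Hironaka's additive group scheme, II*, Publ. RIMS 19 (1983)
1163–1179 [Oda1983HironakaGroupSchemeII], §2 p. 1168). Oda, Cor. 2.3 (p. 1171, held text
`paper:doi-10-2977-prims-1195182025` chunk p0009 L10–19), verbatim: "The Hironaka subgroup schemes `B`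
in `Spec(S)` are in one-to-one correspondence with the proper `F^{−∞}(k)`-subspaces `V` of
`F^{−∞}(k) ⊗_k L₀` satisfying … Moreover, `exponent(B) ≤ e` if and only if the corresponding `V` is
defined over `F^{−e}(k)`. The dimension of `B` equals the codimension of `V`"; and p. 1175 L7: "Since `B`
is not a vector subgroup scheme, i.e., `exponent(B) ≠ 0`". For a PERFECT field `k` one has
`F^{−0}(k) = k = F^{−∞}(k)`, so every `V` is defined over `F^{−0}(k)` and every Hironaka subgroup scheme
has exponent `0`, i.e. is a vector group (H. Hironaka prints the same conclusion under "`K″` algebraically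
closed": *Certain numerical characters of singularities*, J. Math. Kyoto Univ. 10 (1970), p. 170
L20–22, "Since `K″` is algebraically closed, `U″` is generated by its linear homogeneous part"). This
specialisation is not printed as a sentence in the held sources (reading note
`HOME/lit/res-lit-4/HIRONAKA-GROUPS-PERFECT-FIELD.md` of the HIRONAKA campaign, res-hironaka cell); this
file PROVES it on the tree's typed form of Oda's description, in which `B(𝔭)` is given by its graded
module of invariant additive forms `invForms k p 𝔭 e = (L_B)_e` and "exponent `≤ e`" is the predicate
`ExponentLE k p 𝔭 e` (`(L_B)_j = k · F^{j−e}(L_B)_e` for `j ≥ e`):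

* `mem_frobPow_of_perfect` — `k^{p^e} = k` for `k` perfect;
* `apply_eq_mul_of_mem_frobPow` — a `k^{p^e}`-linear map `D : k → k` satisfies `D a = a · D 1` for
  `a ∈ k^{p^e}`; hence over a perfect field every admissible `D ∈ Diff_{p^e−1}(k/k^{p^e})` is a scalar;
* `mem_invForms_zero_iff` — in degree `p^0 = 1` (any `k`): `a ∈ (L_B)_0 ↔ Σ a_j X_j ∈ 𝔭`;
* `mem_invForms_iff_of_perfect` — `k` perfect: `a ∈ (L_B)_e ↔ Σ a_j X_j^{p^e} ∈ 𝔭`;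
* `addForm_frobVec` — `Σ b_j^{p^e} X_j^{p^e} = (Σ b_j X_j)^{p^e}` (Frobenius);
* `exponentLE_zero_of_isRadical` — **`k` perfect, `𝔭` radical (e.g. a point: a homogeneous prime)
  ⇒ `ExponentLE k p 𝔭 0`**: `B(𝔭)` is a vector group in EVERY characteristic;
* `exponentLE_zero_of_isPoint` — the same for Oda's points `𝔭` (`IsPoint`).

The elementary kernel (additive forms over a perfect field are `p^e`-th powers of linear forms, and a
radical ideal containing the power contains the linear form) is also recorded, for polynomial ideals, in
`Literature/Barriers/ResolutionOfSingularities/DirectrixSmallCharacteristic.lean` §`PerfectResidueField`;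
here it is threaded through Oda's differential-operator description of `(L_B)_e`. 0 new facts.
AI-written; AI review is weaker than expert review; nothing here is a resolution theorem.

References: [Oda1983HironakaGroupSchemeII] §2 p. 1168, Lemma 2.1 p. 1169, Cor. 2.3 p. 1171, p. 1175 L7;
[Mizutani1973HironakaGroupSchemes] Remark 1.2 ("`B` is a vector group iff the exponent of `B` equals 0");
H. Hironaka, J. Math. Kyoto Univ. 10 (1970) p. 170 L20–22.
-/

open MvPolynomial

namespace Literature.AlgebraicGeometry.Resolution.HironakaScheme

universe u

variable {k : Type u} [Field k] {p : ℕ} [Fact p.Prime] [CharP k p] {n : ℕ}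

/-! ### The subfield `k^{p^e}` over a perfect field -/

/-- Membership in `k^{p^e} = F^e(k)`: `a ∈ k^{p^e} ↔ a = b^{p^e}` for some `b`.
[cite: Oda1983HironakaGroupSchemeII, §2 (p. 1168: F^e(k))] -/
theorem mem_frobPow_iff (e : ℕ) (a : k) : a ∈ frobPow k p e ↔ ∃ b : k, b ^ p ^ e = a := by
  simp only [frobPow, RingHom.mem_fieldRange, iterateFrobenius_def]

/-- Over a PERFECT field, `k^{p^e} = k`: every element is a `p^e`-th power.
[cite: Oda1983HironakaGroupSchemeII, Cor. 2.3 (case F^{-0}(k) = F^{-∞}(k) for k perfect)] -/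
theorem mem_frobPow_of_perfect [PerfectRing k p] (e : ℕ) (a : k) : a ∈ frobPow k p e := by
  rw [mem_frobPow_iff]
  induction e generalizing a with
  | zero => exact ⟨a, by rw [pow_zero, pow_one]⟩
  | succ e ih =>
    obtain ⟨c, hc⟩ := (PerfectRing.bijective_frobenius (R := k) (p := p)).2 a
    have hc' : c ^ p = a := hc
    obtain ⟨b, hb⟩ := ih c
    exact ⟨b, by rw [pow_succ, pow_mul, hb, hc']⟩

/-- In degree `0`, `k^{p^0} = k` for every field. [cite: Oda1983HironakaGroupSchemeII, §2 (p. 1168)] -/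
private theorem mem_frobPow_zero (a : k) : a ∈ frobPow k p 0 :=
  (mem_frobPow_iff 0 a).mpr ⟨a, by rw [pow_zero, pow_one]⟩

/-- A `k^{p^e}`-linear endomorphism `D` of `k` is multiplication by `D 1` on `k^{p^e}`:
`D (a x) = a · D x` for `a ∈ k^{p^e}`. [cite: Oda1983HironakaGroupSchemeII, §2 (p. 1168: Diff(k/F^e(k)))] -/
theorem apply_mul_eq_of_mem_frobPow {e : ℕ} (D : k →ₗ[frobPow k p e] k) {a : k}
    (ha : a ∈ frobPow k p e) (x : k) : D (a * x) = a * D x := by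
  have h := D.map_smul (⟨a, ha⟩ : frobPow k p e) x
  simpa only [Subfield.smul_def, smul_eq_mul] using h

/-- Over a perfect field every `k^{p^e}`-linear `D : k → k` is the scalar `D 1`: `D a = a · D 1`.
[cite: Oda1983HironakaGroupSchemeII, §2 (p. 1168)] -/
theorem apply_eq_mul_of_perfect [PerfectRing k p] {e : ℕ} (D : k →ₗ[frobPow k p e] k) (a : k) :
    D a = a * D 1 := by
  simpa only [mul_one] using apply_mul_eq_of_mem_frobPow D (mem_frobPow_of_perfect e a) 1

/-! ### Invariant forms when the admissible operators are scalars -/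

omit [Fact p.Prime] [CharP k p] in
/-- Scaling the coefficients scales the additive form: `Σ (c a_j) X_j^{p^e} = c · Σ a_j X_j^{p^e}`.
[cite: Oda1983HironakaGroupSchemeII, §2 (p. 1168: L_e a k-vector space)] -/
theorem addForm_mul_left (e : ℕ) (c : k) (a : Fin (n + 1) → k) :
    addForm k p e (fun j => c * a j) = C c * addForm k p e a := by
  simp only [addForm, Finset.mul_sum, C_mul, mul_assoc]

/-- If every admissible operator is a scalar on the coefficients (which holds whenever `k^{p^e} = k`),
membership in `(L_B)_e` is just `Σ a_j X_j^{p^e} ∈ 𝔭`. [cite: Oda1983HironakaGroupSchemeII, §2 (p. 1168, display (L_B)_e)] -/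
theorem mem_invForms_iff_of_forall_mem_frobPow {e : ℕ} (hk : ∀ a : k, a ∈ frobPow k p e)
    (𝔭 : Ideal (MvPolynomial (Fin (n + 1)) k)) (a : Fin (n + 1) → k) :
    a ∈ invForms k p 𝔭 e ↔ addForm k p e a ∈ 𝔭 := by
  constructor
  · intro h
    have hid : IsCoeffDiffOp k p e (p ^ e - 1) (LinearMap.id : k →ₗ[frobPow k p e] k) :=
      IsDiffOpLE.of_le (Nat.zero_le _) (isDiffOpLE_id (R := frobPow k p e))
    simpa only [LinearMap.id_coe, id_eq] using h LinearMap.id hid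
  · intro h D _
    have hD : (fun j => D (a j)) = fun j => D 1 * a j := by
      funext j
      rw [mul_comm]
      simpa only [mul_one] using apply_mul_eq_of_mem_frobPow D (hk (a j)) 1
    change addForm k p e (fun j => D (a j)) ∈ 𝔭
    rw [hD, addForm_mul_left]
    exact Ideal.mul_mem_left _ _ h

/-- **Degree `p^0 = 1` (any field `k`)**: `a ∈ (L_B)_0 ↔ Σ a_j X_j ∈ 𝔭` — the invariant LINEAR forms
are the linear forms in `𝔭`. [cite: Oda1983HironakaGroupSchemeII, §2 (p. 1168)] -/
theorem mem_invForms_zero_iff (𝔭 : Ideal (MvPolynomial (Fin (n + 1)) k)) (a : Fin (n + 1) → k) :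
    a ∈ invForms k p 𝔭 0 ↔ addForm k p 0 a ∈ 𝔭 :=
  mem_invForms_iff_of_forall_mem_frobPow mem_frobPow_zero 𝔭 a

/-- **Over a PERFECT field**: `a ∈ (L_B)_e ↔ Σ a_j X_j^{p^e} ∈ 𝔭` (the differential-operator
condition of Oda's description is vacuous, `Diff(k/k^{p^e}) = Diff(k/k) = k`).
[cite: Oda1983HironakaGroupSchemeII, §2 (p. 1168) and Cor. 2.3] -/
theorem mem_invForms_iff_of_perfect [PerfectRing k p] (e : ℕ)
    (𝔭 : Ideal (MvPolynomial (Fin (n + 1)) k)) (a : Fin (n + 1) → k) :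
    a ∈ invForms k p 𝔭 e ↔ addForm k p e a ∈ 𝔭 :=
  mem_invForms_iff_of_forall_mem_frobPow (mem_frobPow_of_perfect e) 𝔭 a

/-! ### Frobenius on additive forms -/

/-- `Σ_j b_j^{p^e} X_j^{p^e} = (Σ_j b_j X_j)^{p^e}`: the additive form with coefficient vector `F^e b` is
the `p^e`-th power of the linear form with coefficient vector `b`.
[cite: Oda1983HironakaGroupSchemeII, §2 (p. 1168: L = k[F] ⊗ L_0)] -/
theorem addForm_frobVec (e : ℕ) (b : Fin (n + 1) → k) :
    addForm k p e (frobVec k p e b) = addForm k p 0 b ^ p ^ e := by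
  haveI : CharP (MvPolynomial (Fin (n + 1)) k) p := inferInstance
  simp only [addForm, frobVec, pow_zero, pow_one]
  rw [sum_pow_char_pow]
  refine Finset.sum_congr rfl fun j _ => ?_
  rw [mul_pow, ← C_pow]

/-- Over a perfect field every coefficient vector is `F^e` of another: `a = F^e b`.
[cite: Oda1983HironakaGroupSchemeII, Cor. 2.3 (k perfect: F^{-e}(k) = k)] -/
theorem exists_eq_frobVec_of_perfect [PerfectRing k p] (e : ℕ) (a : Fin (n + 1) → k) :
    ∃ b : Fin (n + 1) → k, frobVec k p e b = a := by
  choose b hb using fun j => (mem_frobPow_iff e (a j)).mp (mem_frobPow_of_perfect e (a j))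
  exact ⟨b, funext hb⟩

/-! ### Exponent zero over a perfect field -/

/-- **Over a PERFECT field every Hironaka subgroup scheme `B(𝔭)`, `𝔭` a radical ideal (e.g. a
homogeneous prime = a point of `ℙⁿ`), has exponent `0`, i.e. is a VECTOR GROUP, in every
characteristic `p`**: `(L_B)_j = k · F^j (L_B)_0` for all `j`. Proof: an invariant form of degree `p^j`
is `Σ a_i X_i^{p^j}` lying in `𝔭` (`mem_invForms_iff_of_perfect`); write `a = F^j b`
(`exists_eq_frobVec_of_perfect`), so `(Σ b_i X_i)^{p^j} ∈ 𝔭`, whence `Σ b_i X_i ∈ 𝔭` as `𝔭` is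
radical, i.e. `b ∈ (L_B)_0`. Oda's Cor. 2.3 with `F^{-0}(k) = F^{-∞}(k)`; Hironaka 1970 p. 170 L20–22
under "algebraically closed". [cite: Oda1983HironakaGroupSchemeII, Cor. 2.3 (p. 1171) with p. 1175 L7; Mizutani1973HironakaGroupSchemes, Remark 1.2] -/
theorem exponentLE_zero_of_isRadical [PerfectRing k p] (𝔭 : Ideal (MvPolynomial (Fin (n + 1)) k))
    (h𝔭 : 𝔭.IsRadical) : ExponentLE k p 𝔭 0 := by
  intro j _
  rw [Nat.sub_zero]
  apply le_antisymm
  · intro a ha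
    obtain ⟨b, rfl⟩ := exists_eq_frobVec_of_perfect j a
    refine Submodule.subset_span ⟨b, ?_, rfl⟩
    rw [SetLike.mem_coe, mem_invForms_zero_iff]
    rw [mem_invForms_iff_of_perfect, addForm_frobVec] at ha
    exact h𝔭 ⟨p ^ j, ha⟩
  · rw [Submodule.span_le]
    rintro _ ⟨b, hb, rfl⟩
    rw [SetLike.mem_coe, mem_invForms_zero_iff] at hb
    rw [SetLike.mem_coe, mem_invForms_iff_of_perfect, addForm_frobVec]
    exact Ideal.pow_mem_of_mem 𝔭 hb (p ^ j) (pow_pos (Fact.out : p.Prime).pos j)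

/-- The same for Oda's POINTS of `ℙⁿ_k` (homogeneous primes `𝔭 ≠ S_+`): over a perfect field, `B(𝔭)`
is a vector group. [cite: Oda1983HironakaGroupSchemeII, Cor. 2.3 (p. 1171) with §2 p. 1168 (points 𝔭)] -/
theorem exponentLE_zero_of_isPoint [PerfectRing k p] {𝔭 : Ideal (MvPolynomial (Fin (n + 1)) k)}
    (h𝔭 : IsPoint k 𝔭) : ExponentLE k p 𝔭 0 :=
  haveI := h𝔭.1
  exponentLE_zero_of_isRadical 𝔭 (Ideal.IsPrime.isRadical ‹_›)

/-- Consequently over a perfect field `B(𝔭)` has exponent `≤ e` for EVERY `e` (monotonicity of the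
exponent condition, `ExponentLE.mono`). [cite: Oda1983HironakaGroupSchemeII, Cor. 2.3 (p. 1171)] -/
theorem exponentLE_of_isRadical_of_perfect [PerfectRing k p]
    (𝔭 : Ideal (MvPolynomial (Fin (n + 1)) k)) (h𝔭 : 𝔭.IsRadical) (e : ℕ) : ExponentLE k p 𝔭 e :=
  (exponentLE_zero_of_isRadical 𝔭 h𝔭).mono (Nat.zero_le e)

end Literature.AlgebraicGeometry.Resolution.HironakaScheme
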